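/-
Copyright (c) 2026 the pub-hodgecm-mathlib formalisation cell (harness21).  Prover seat hodgecm-mathlib-LH5-p04 (g9); G-rows dealer ∕ reader F0P3a-p09 (g13) (LEAD F0P3a-plan
T14-67 rule 20 ∕ T14-69 (1)); G-ROW LEDGER v3 row (G2)-RAM-TAME «EULER-G-RAM» (DEAL 23:09:35Z), spec = CENSUS «(G2)∕(G1)-RAM» v1 54c621b9 (F0P2-p02 (g24)) §1–§2; 2026-09-02.
The tame-ramified twin of ★ `UnitaryLatticeTreeEulerRelation` (LH6-p03 (g8), p852868), re-lettered row by row; nothing of that file is restated under its own name.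
-/
import Literature.NumberTheory.Automorphic.UnitaryLatticeTreeFixedCosetFlags              -- ★ FILE 1 p852856 (LH6-p03): dictionaries (A)(B)(I) `exists_fixedBy_{equiv_fixed_selfDual,conj_equiv_fixed_type,inf_equiv_fixed_flags}_rankN`, `mk_eq_mk_iff_mapGL_stdLattice_eq`
import Literature.NumberTheory.Automorphic.UnitaryLatticeTreeFramesOfInvolution            -- ★ `isTree_latticeGraph_three_of_neg`; brings ★ `…TypeTwoTransitiveRamified` (`forall_isVertexLattice_two_exists_mapGL_N₁_eq_of_neg`)
import Literature.NumberTheory.Automorphic.UnitaryLatticeTreeRootStarOrbitOfInvolution     -- ★ `exists_mem_unitaryInt_eq_mapGL_N₁_of_lt_of_trace`, `mapGL_N₁_lt_stdLattice_of_v`; brings ★ `…StarOfInvolution` (`isSelfDualLattice_stdLattice_three_of_v`, `not_isSelfDualLattice_of_isVertexLattice_two_of_v`) + ★ `…SelfDualTransitiveOfTrace`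
import Literature.NumberTheory.Automorphic.UnitaryLatticeTreeApartmentOfInvolution         -- ★ `isVertexLattice_two_N₁_of_v`
import Literature.Combinatorics.SimpleGraph.TreeRootedCriterionFixedSubtree                -- ★ `RootedTree.ncard_fixedPoints_eq_ncard_fixedEdges_add_one`, `RootedTree.exists_fixedPoint_of_finite_invariant`
import HarnessLib

/-!
# THE ELLIPTIC EULER–POINCARÉ RELATION `#Fix_γ(U⧸K₀) + #Fix_γ(U⧸K₁) = #Fix_γ(U⧸(K₀ ⊓ K₁)) + 1` ON THE `U(3)` LATTICE TREE AT A TAME RAMIFIED PLACE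
# (Kottwitz 1988 §2; Serre, *Trees*, I.6.1 ∕ II.1.1; Bruhat–Tits 1972 §10; Tits 1979 §2.4) — «EULER-G-RAM», the `σϖ = −ϖ` twin of ★ `UnitaryLatticeTreeEulerRelation`

Topic `NumberTheory/Automorphic`; namespace `Literature.NumberTheory.Automorphic.UnitaryLatticeTree`.  THEOREMS ONLY (no definition ∕ instance ∕ notation ∕ named fact ∕ `sorry`).
Cell `pub/hodgecm-mathlib`, crux H413 = `stmt-HodgeConjecture-24833` (`--supports` lane, helper); LEAD F0P3a-plan T14-67 rule-20 brick; G-ROW LEDGER v3 row **(G2)-RAM-TAME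
«EULER-G-RAM»** (G-row dealer F0P3a-p09 (g13), DEAL BY NAME 23:09:35Z), spec = CENSUS «(G2)∕(G1)-RAM» v1 (F0P2-p02 (g24)) §1–§2.  Seat LH5-p04 (g9).

THE SETTING (the «ramified block» of ★ `isTree_latticeGraph_three_of_neg` ∕ F0P3a-p07, binders copied verbatim): `K` a field with `Valued K ℤᵐ⁰` (and the compatible `ValuativeRel`,
for ★ `glInt`), `σ : K →+* K` an involution (`hσ`) preserving the valuation (`hvσ`), `ϖ` a uniformiser (`hϖ`) with **`σ ϖ = −ϖ`** (`hσϖ`: the quadratic extension is RAMIFIED and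
`ϖ` is chosen anti-invariant), `σ` residually trivial (`hres`), `|2| = 1` (`h2`: TAME), and the first-order norm surjectivity on `σ`-fixed one-units (`hnorm`, verbatim the (norm) field of
★ `UnramifiedLocalConjDatum`).  `J₀ = antidiag(1,1,1)`, `U := unitaryGroupOfForm σ J₀ ≤ GL₃(K)`, `L₀ = 𝒪³` the self-dual root (★ `isSelfDualLattice_stdLattice_three_of_v`), `g₁ = diag(1,1,ϖ)`,
`N₁ = g₁·L₀ = latt diag(1,1,ϖ)` of type two (★ `isVertexLattice_two_N₁_of_v`), `K₀ = (glInt 3 K).subgroupOf U`, `K₁ = ((glInt 3 K).map (MulAut.conj g₁).toMonoidHom).subgroupOf U` — the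
spellings of ★ `UnitaryLatticeTreeFixedCosetFlags` ∕ ★ `UnitaryLatticeTreeLevelIndices` (both vertex stabilisers are SPECIAL at a ramified place; valency `q + 1` each).

THE THEOREM (`natCard_fixedBy_add_eq_natCard_fixedBy_inf_add_one_three_of_neg`): for `γ ∈ U` with finitely many fixed cosets in `U ⧸ K₀`, `U ⧸ K₁` and a finite `⟨γ⟩`-orbit of the root
coset, `Nat.card Fix_γ(U ⧸ K₀) + Nat.card Fix_γ(U ⧸ K₁) = Nat.card Fix_γ(U ⧸ (K₀ ⊓ K₁)) + 1` — the SAME conclusion as the unramified ★ `natCard_fixedBy_add_eq_natCard_fixedBy_inf_add_one_three`.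
PROOF = the unramified proof re-lettered row by row over the datum-free twins (census §1): tree ★ `isTree_latticeGraph_three_of_neg`; transitivity on self-dual vertices (A) ★
`exists_unitary_mapGL_stdLattice_eq_of_isSelfDualLattice_of_trace` with the trace element `t = 1∕2` (`|1∕2| = 1`, `1∕2 + σ(1∕2) = 1`); on type-two vertices (B) ★
`forall_isVertexLattice_two_exists_mapGL_N₁_eq_of_neg`; on edges (I) `forall_flag_exists_unitary_of_v_two` below (★ `exists_mem_unitaryInt_eq_mapGL_N₁_of_lt_of_trace`); dictionaries ★
FILE 1; fixed flags ≃ fixed edges (`nonempty_fixed_flags_equiv_fixed_edges_three_of_v`); a fixed vertex (`exists_latticeGraphIso_apply_eq_self_three_of_neg`); the count ★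
`RootedTree.ncard_fixedPoints_eq_ncard_fixedEdges_add_one`.
* `forall_flag_exists_unitary_of_v_two` (edge transitivity for ANY involution with `|2| = 1`), `nonempty_fixed_flags_equiv_fixed_edges_three_of_v` (any valuation-preserving `σ`),
  `exists_latticeGraphIso_apply_eq_self_three_of_neg`, **`natCard_fixedBy_add_eq_natCard_fixedBy_inf_add_one_three_of_neg`**.

CONSUMER-IN-WAITING: the `hE` binder of ★ `Rogawski1990/RankOneEulerPoincareGlue.exists_isLocSmooth_classOrbitalIntegral_eq_one_zero_of_relations` at a TAME RAMIFIED non-split place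
(a later (G3)-RAM; with (G1)-RAM, census §3, Kottwitz's `f_EP^G` then exists at every tame non-split place).  WILD ∕ dyadic ramified places are NOT covered (census §4: open at
transitivity).  HONEST LABEL: count-neutral rule-20 brick (a combinatorial letter about fixed cosets; nothing printed is asserted; it widens the EP-G column to tame ramified places,
instances only at t1′); h413 OPEN; HC_CM is proved only modulo the 7 printed citations (2 remaining named inputs hLiu418 = stmt-HodgeConjecture-24832, h413 = stmt-HodgeConjecture-24833)
until rung 0 closes.

## References
* [Kottwitz1988] R. E. Kottwitz, *Tamagawa numbers*, Ann. of Math. 127 (1988), §2 (Euler–Poincaré functions and fixed facets of the building).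
* [Serre1980Trees] J.-P. Serre, *Trees* (1980), I.6.1 (a group acting without inversion with a bounded orbit fixes a vertex), II.1.1 (lattice trees).
* [BruhatTits1972] F. Bruhat, J. Tits, *Groupes réductifs sur un corps local I*, Publ. IHÉS 41 (1972), §3.2, §10 (fixed points of bounded subgroups; unitary groups).
* [Tits1979] J. Tits, *Reductive groups over local fields*, PSPM 33.1 (1979), §2.4 (the ramified quasi-split `²A₂`: local index `(q+1, q+1)`), §3.5.
* [Rogawski1990] J. D. Rogawski, *Automorphic representations of unitary groups in three variables*, Ann. of Math. Stud. 123 (1990), §12.3 p. 176 (Euler–Poincaré functions at non-split places).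
-/

set_option autoImplicit false

noncomputable section

open Matrix Literature.NumberTheory.Automorphic Literature.Combinatorics.SimpleGraph
open Literature.NumberTheory.Automorphic.HermitianLattice Literature.NumberTheory.Automorphic.UnitaryGroup Literature.NumberTheory.Automorphic.CartanUnique
open scoped Matrix MatrixGroups WithZero Valued

namespace Literature.NumberTheory.Automorphic.UnitaryLatticeTree

variable {K : Type*} [Field K] [Valued K ℤᵐ⁰] [ValuativeRel K] [(Valued.v : Valuation K ℤᵐ⁰).Compatible]

/-! ## `N = 3`, `J₀ = antidiag(1,1,1)`, tame ramified (`σϖ = −ϖ`, `|2| = 1`): edges, a fixed vertex, and the Euler–Poincaré relation -/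

section ThreeRamified

variable {σ : K →+* K} {ϖ : K}

omit [ValuativeRel K] [(Valued.v : Valuation K ℤᵐ⁰).Compatible] in
/-- **`U(σ, J₀)` IS TRANSITIVE ON THE EDGES, `|2| = 1`, ANY INVOLUTION** (flags `M < L`, `L` self-dual, `M` of type two), in particular at a TAME RAMIFIED place (`σϖ = −ϖ`):
move `L` to the root by the datum-free self-dual transitivity ★ `exists_unitary_mapGL_stdLattice_eq_of_isSelfDualLattice_of_trace` with the trace element `t = 1∕2`, then
`M` into `N₁ = g₁·L₀` inside the star of the root by an element of `K₀` (★ `exists_mem_unitaryInt_eq_mapGL_N₁_of_lt_of_trace`, `N₁` of type two by ★ `isVertexLattice_two_N₁_of_v`).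
The unramified twin is ★ `forall_flag_exists_unitary`. [cite: BruhatTits1972, §10] [cite: Serre1980Trees, II.1.1] [cite: Tits1979, §3.5] -/
theorem forall_flag_exists_unitary_of_v_two (hσ : ∀ x, σ (σ x) = x) (hvσ : ∀ a, Valued.v (σ a) = Valued.v a) (hϖ : Valued.v ϖ = WithZero.exp (-1 : ℤ)) (h2 : Valued.v (2 : K) = 1)
    (g₁ : GL (Fin 3) K) (hg₁ : (g₁ : Matrix (Fin 3) (Fin 3) K) = Matrix.diagonal ![(1 : K), 1, ϖ]) :
    ∀ L M : Submodule (Valued.integer K) (Fin 3 → K), IsSelfDualLattice σ ϖ ((StdForm.antidiagonal 3).over K) L → IsVertexLattice σ ϖ ((StdForm.antidiagonal 3).over K) 2 M → M < L →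
      ∃ u : ↥(unitaryGroupOfForm σ ((StdForm.antidiagonal 3).over K)), mapGL (u : GL (Fin 3) K) (stdLattice K 3) = L ∧ mapGL ((u : GL (Fin 3) K) * g₁) (stdLattice K 3) = M := by
  intro L M hL hM hlt
  have h20 : (2 : K) ≠ 0 := fun h => by rw [h, map_zero] at h2; exact zero_ne_one h2
  have htrace : ∃ t : K, Valued.v t ≤ 1 ∧ t + σ t = 1 :=
    ⟨2⁻¹, by rw [Valuation.map_inv, h2, inv_one], by rw [map_inv₀ σ (2 : K), map_ofNat σ 2, ← two_mul, mul_inv_cancel₀ h20]⟩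
  obtain ⟨u₀, hu₀⟩ := exists_unitary_mapGL_stdLattice_eq_of_isSelfDualLattice_of_trace hσ hvσ hϖ htrace hL
  -- `u₀⁻¹·M < L₀` is a type-two vertex below the root, hence `κ·N₁` with `κ ∈ K₀`
  have hM' : IsVertexLattice σ ϖ ((StdForm.antidiagonal 3).over K) 2 (mapGL ((u₀⁻¹ : ↥(unitaryGroupOfForm σ ((StdForm.antidiagonal 3).over K))) : GL (Fin 3) K) M) :=
    isVertexLattice_mapGL σ ϖ _ _ (u₀⁻¹).2 hM
  have hlt' : mapGL ((u₀⁻¹ : ↥(unitaryGroupOfForm σ ((StdForm.antidiagonal 3).over K))) : GL (Fin 3) K) M < stdLattice K 3 := by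
    have h := (mapGL_lt_mapGL_iff ((u₀⁻¹ : ↥(unitaryGroupOfForm σ ((StdForm.antidiagonal 3).over K))) : GL (Fin 3) K) _ _).2 hlt
    rwa [← hu₀, ← mapGL_mul, Subgroup.coe_inv, inv_mul_cancel, mapGL_one] at h
  obtain ⟨κ, hκ, hκM⟩ := exists_mem_unitaryInt_eq_mapGL_N₁_of_lt_of_trace hσ hvσ hϖ htrace
    (isVertexLattice_two_N₁_of_v hvσ (uniformizer_mem_integer hϖ) (uniformizer_ne_zero hϖ)) hM' hlt'
  refine ⟨u₀ * κ, ?_, ?_⟩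
  · rw [Subgroup.coe_mul, mapGL_mul, mapGL_stdLattice_of_mem_unitaryInt hκ, hu₀]
  · have hN₁ : mapGL g₁ (stdLattice K 3) = latt (Matrix.diagonal ![(1 : K), 1, ϖ]) := by rw [← hg₁]; rfl
    rw [Subgroup.coe_mul, mapGL_mul, mapGL_mul, hN₁, ← hκM, ← mapGL_mul, Subgroup.coe_inv, mul_inv_cancel, mapGL_one]

omit [ValuativeRel K] [(Valued.v : Valuation K ℤᵐ⁰).Compatible] in
/-- **(I, flags → edges), ANY valuation-preserving `σ`**: the `γ`-fixed flags `(L, M)` (`L` self-dual, `M` of type two, `M < L`) ≃ the `γ`-fixed edges of ★ `latticeGraph σ ϖ J₀`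
(★ `type_of_lt_three`; no vertex is both, ★ `not_isSelfDualLattice_of_isVertexLattice_two_of_v`).  Datum-free twin of ★ `nonempty_fixed_flags_equiv_fixed_edges_three`.
[cite: Serre1980Trees, II.1.1] [cite: BruhatTits1972, §10] -/
theorem nonempty_fixed_flags_equiv_fixed_edges_three_of_v (hvσ : ∀ a, Valued.v (σ a) = Valued.v a) (hϖ : Valued.v ϖ = WithZero.exp (-1 : ℤ))
    (γ : ↥(unitaryGroupOfForm σ ((StdForm.antidiagonal 3).over K))) :
    Nonempty ({p : {M : Submodule (Valued.integer K) (Fin 3 → K) // IsVertex σ ϖ ((StdForm.antidiagonal 3).over K) M} ×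
        {M : Submodule (Valued.integer K) (Fin 3 → K) // IsVertex σ ϖ ((StdForm.antidiagonal 3).over K) M} //
        IsSelfDualLattice σ ϖ ((StdForm.antidiagonal 3).over K) p.1.1 ∧ IsVertexLattice σ ϖ ((StdForm.antidiagonal 3).over K) 2 p.2.1 ∧ p.2.1 < p.1.1 ∧
          latticeGraphIso σ ϖ ((StdForm.antidiagonal 3).over K) γ p.1 = p.1 ∧ latticeGraphIso σ ϖ ((StdForm.antidiagonal 3).over K) γ p.2 = p.2} ≃
      ↥{e ∈ (latticeGraph σ ϖ ((StdForm.antidiagonal 3).over K)).edgeSet | ∀ v ∈ e, latticeGraphIso σ ϖ ((StdForm.antidiagonal 3).over K) γ v = v}) := by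
  classical
  have hnot : ∀ M : Submodule (Valued.integer K) (Fin 3 → K), IsVertexLattice σ ϖ ((StdForm.antidiagonal 3).over K) 2 M →
      ¬ IsSelfDualLattice σ ϖ ((StdForm.antidiagonal 3).over K) M := fun M hM2 => not_isSelfDualLattice_of_isVertexLattice_two_of_v hvσ hϖ hM2
  refine ⟨Equiv.ofBijective (fun p => ⟨s(p.1.1, p.1.2), ?_, ?_⟩) ⟨?_, ?_⟩⟩
  · rw [SimpleGraph.mem_edgeSet, latticeGraph_adj_iff]
    exact Or.inr p.2.2.2.1
  · intro v hv
    rw [Sym2.mem_iff] at hv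
    rcases hv with rfl | rfl
    · exact p.2.2.2.2.1
    · exact p.2.2.2.2.2
  · intro p q hpq
    have h : s(p.1.1, p.1.2) = s(q.1.1, q.1.2) := congrArg Subtype.val hpq
    rw [Sym2.eq_iff] at h
    rcases h with ⟨h1, h2⟩ | ⟨h1, h2⟩
    · exact Subtype.ext (Prod.ext h1 h2)
    · exact (hnot _ (by rw [h1]; exact q.2.2.1) p.2.1).elim
  · rintro ⟨e, he, hfix⟩
    induction e using Sym2.ind with
    | h a b =>
      rw [SimpleGraph.mem_edgeSet, latticeGraph_adj_iff] at he
      obtain ⟨da, ha⟩ := a.2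
      obtain ⟨db, hb⟩ := b.2
      rcases he with hlt | hlt
      · have ht := type_of_lt_three hvσ hϖ v_det_antidiagonal_three ha hb hlt
        rw [ht.1] at ha
        rw [ht.2] at hb
        refine ⟨⟨(b, a), hb, ha, hlt, hfix b (Sym2.mem_mk_right a b), hfix a (Sym2.mem_mk_left a b)⟩, ?_⟩
        apply Subtype.ext
        exact Sym2.eq_swap
      · have ht := type_of_lt_three hvσ hϖ v_det_antidiagonal_three hb ha hlt
        rw [ht.1] at hb
        rw [ht.2] at ha
        exact ⟨⟨(a, b), ha, hb, hlt, hfix a (Sym2.mem_mk_left a b), hfix b (Sym2.mem_mk_right a b)⟩, rfl⟩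

/-- **A vertex fixed by `γ`, TAME RAMIFIED place**: if the `⟨γ⟩`-orbit of the root coset `K₀` is finite, `γ` fixes a vertex of the tame-ramified tree (★ `isTree_latticeGraph_three_of_neg`;
the orbit of the root is a finite non-empty `γ`-stable vertex set and `γ` preserves the type colouring; ★ `RootedTree.exists_fixedPoint_of_finite_invariant`).  Twin of ★
`exists_latticeGraphIso_apply_eq_self_three`. [cite: Serre1980Trees, I.6.1] [cite: BruhatTits1972, §3.2] -/
theorem exists_latticeGraphIso_apply_eq_self_three_of_neg (hσ : ∀ x, σ (σ x) = x) (hvσ : ∀ a, Valued.v (σ a) = Valued.v a) (hϖ : Valued.v ϖ = WithZero.exp (-1 : ℤ)) (hσϖ : σ ϖ = -ϖ)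
    (hres : ∀ x : K, Valued.v x ≤ 1 → Valued.v (σ x - x) < 1) (h2 : Valued.v (2 : K) = 1)
    (hnorm : ∀ u : K, σ u = u → Valued.v (u - 1) < 1 → ∃ z : K, z * σ z = u ∧ Valued.v (z - 1) ≤ Valued.v (u - 1))
    (γ : ↥(unitaryGroupOfForm σ ((StdForm.antidiagonal 3).over K)))
    (horb : (Set.range fun n : ℕ => ((γ ^ n : ↥(unitaryGroupOfForm σ ((StdForm.antidiagonal 3).over K))) :
      ↥(unitaryGroupOfForm σ ((StdForm.antidiagonal 3).over K)) ⧸ (glInt 3 K).subgroupOf (unitaryGroupOfForm σ ((StdForm.antidiagonal 3).over K)))).Finite) :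
    ∃ v : {M : Submodule (Valued.integer K) (Fin 3 → K) // IsVertex σ ϖ ((StdForm.antidiagonal 3).over K) M}, latticeGraphIso σ ϖ ((StdForm.antidiagonal 3).over K) γ v = v := by
  classical
  have hT := isTree_latticeGraph_three_of_neg hσ hvσ hϖ hσϖ hres h2 hnorm
  have hroot : IsSelfDualLattice σ ϖ ((StdForm.antidiagonal 3).over K) (stdLattice K 3) := isSelfDualLattice_stdLattice_three_of_v hϖ
  have hnot : ∀ M : Submodule (Valued.integer K) (Fin 3 → K), IsVertexLattice σ ϖ ((StdForm.antidiagonal 3).over K) 2 M →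
      ¬ IsSelfDualLattice σ ϖ ((StdForm.antidiagonal 3).over K) M := fun M hM2 => not_isSelfDualLattice_of_isVertexLattice_two_of_v hvσ hϖ hM2
  -- the type colouring: self-dual ↦ 0, type two ↦ 1
  have hval : ∀ v w : {M : Submodule (Valued.integer K) (Fin 3 → K) // IsVertex σ ϖ ((StdForm.antidiagonal 3).over K) M},
      (latticeGraph σ ϖ ((StdForm.antidiagonal 3).over K)).Adj v w →
        (if IsSelfDualLattice σ ϖ ((StdForm.antidiagonal 3).over K) v.1 then (0 : Fin 2) else 1) ≠
          (if IsSelfDualLattice σ ϖ ((StdForm.antidiagonal 3).over K) w.1 then (0 : Fin 2) else 1) := by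
    intro v w hvw
    rw [latticeGraph_adj_iff] at hvw
    obtain ⟨dv, hv⟩ := v.2
    obtain ⟨dw, hw⟩ := w.2
    rcases hvw with hlt | hlt
    · obtain ⟨rfl, rfl⟩ := type_of_lt_three hvσ hϖ v_det_antidiagonal_three hv hw hlt
      rw [if_neg (hnot _ hv), if_pos hw]; decide
    · obtain ⟨rfl, rfl⟩ := type_of_lt_three hvσ hϖ v_det_antidiagonal_three hw hv hlt
      rw [if_pos hv, if_neg (hnot _ hw)]; decide
  let c : (latticeGraph σ ϖ ((StdForm.antidiagonal 3).over K)).Coloring (Fin 2) :=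
    SimpleGraph.Coloring.mk (fun v => if IsSelfDualLattice σ ϖ ((StdForm.antidiagonal 3).over K) v.1 then (0 : Fin 2) else 1) (fun {v w} hvw => hval v w hvw)
  have hc : ∀ v, c (latticeGraphIso σ ϖ ((StdForm.antidiagonal 3).over K) γ v) = c v := by
    intro v
    change (if IsSelfDualLattice σ ϖ ((StdForm.antidiagonal 3).over K) (latticeGraphIso σ ϖ ((StdForm.antidiagonal 3).over K) γ v).1 then (0 : Fin 2) else 1) =
      (if IsSelfDualLattice σ ϖ ((StdForm.antidiagonal 3).over K) v.1 then (0 : Fin 2) else 1)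
    have h : IsSelfDualLattice σ ϖ ((StdForm.antidiagonal 3).over K) (latticeGraphIso σ ϖ ((StdForm.antidiagonal 3).over K) γ v).1 ↔
        IsSelfDualLattice σ ϖ ((StdForm.antidiagonal 3).over K) v.1 := isVertexLattice_mapGL_iff σ ϖ _ γ v.1
    rw [show (if IsSelfDualLattice σ ϖ ((StdForm.antidiagonal 3).over K) (latticeGraphIso σ ϖ ((StdForm.antidiagonal 3).over K) γ v).1 then (0 : Fin 2) else 1) =
      (if IsSelfDualLattice σ ϖ ((StdForm.antidiagonal 3).over K) v.1 then (0 : Fin 2) else 1) from by simp only [h]]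
  -- the orbit of the root as a vertex set
  let vA : ↥(unitaryGroupOfForm σ ((StdForm.antidiagonal 3).over K)) → {M : Submodule (Valued.integer K) (Fin 3 → K) // IsVertex σ ϖ ((StdForm.antidiagonal 3).over K) M} := fun u =>
    ⟨mapGL (u : GL (Fin 3) K) (stdLattice K 3), ⟨0, isVertexLattice_mapGL σ ϖ _ _ u.2 hroot⟩⟩
  let f : ↥(unitaryGroupOfForm σ ((StdForm.antidiagonal 3).over K)) ⧸ (glInt 3 K).subgroupOf (unitaryGroupOfForm σ ((StdForm.antidiagonal 3).over K)) →
      {M : Submodule (Valued.integer K) (Fin 3 → K) // IsVertex σ ϖ ((StdForm.antidiagonal 3).over K) M} := fun x =>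
    Quotient.liftOn' x vA (by
      intro a b hab
      apply Subtype.ext
      change mapGL _ _ = mapGL _ _
      rw [← mk_eq_mk_iff_mapGL_stdLattice_eq σ ((StdForm.antidiagonal 3).over K) a b]
      exact Quotient.sound' hab)
  have hf : ∀ u : ↥(unitaryGroupOfForm σ ((StdForm.antidiagonal 3).over K)),
      f (u : ↥(unitaryGroupOfForm σ ((StdForm.antidiagonal 3).over K)) ⧸ (glInt 3 K).subgroupOf (unitaryGroupOfForm σ ((StdForm.antidiagonal 3).over K))) = vA u := fun u => rfl
  refine RootedTree.exists_fixedPoint_of_finite_invariant hT (latticeGraphIso σ ϖ ((StdForm.antidiagonal 3).over K) γ) c hc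
    (S := f '' Set.range fun n : ℕ => ((γ ^ n : ↥(unitaryGroupOfForm σ ((StdForm.antidiagonal 3).over K))) :
      ↥(unitaryGroupOfForm σ ((StdForm.antidiagonal 3).over K)) ⧸ (glInt 3 K).subgroupOf (unitaryGroupOfForm σ ((StdForm.antidiagonal 3).over K))))
    (horb.image f) ⟨f ((γ ^ 0 : ↥(unitaryGroupOfForm σ ((StdForm.antidiagonal 3).over K))) :
      ↥(unitaryGroupOfForm σ ((StdForm.antidiagonal 3).over K)) ⧸ (glInt 3 K).subgroupOf (unitaryGroupOfForm σ ((StdForm.antidiagonal 3).over K))), Set.mem_image_of_mem f ⟨0, rfl⟩⟩ ?_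
  rintro s ⟨x, ⟨n, rfl⟩, rfl⟩
  refine ⟨((γ ^ (n + 1) : ↥(unitaryGroupOfForm σ ((StdForm.antidiagonal 3).over K))) :
    ↥(unitaryGroupOfForm σ ((StdForm.antidiagonal 3).over K)) ⧸ (glInt 3 K).subgroupOf (unitaryGroupOfForm σ ((StdForm.antidiagonal 3).over K))), ⟨n + 1, rfl⟩, ?_⟩
  rw [hf, hf]
  apply Subtype.ext
  rw [latticeGraphIso_apply_coe]
  change mapGL _ _ = mapGL _ (mapGL _ _)
  rw [← mapGL_mul, ← Subgroup.coe_mul, ← pow_succ']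

/-- **THE ELLIPTIC EULER–POINCARÉ RELATION ON THE `U(3)` TREE AT A TAME RAMIFIED PLACE («EULER-G-RAM»).**  `K` with `Valued K ℤᵐ⁰`, `σ` an isometric involution with
`σϖ = −ϖ` for the uniformiser `ϖ` (ramified quadratic extension), residually trivial (`hres`), `|2| = 1` (tame), and the first-order norm surjectivity `hnorm` on `σ`-fixed one-units —
the binder block of ★ `isTree_latticeGraph_three_of_neg`, VERBATIM; `U = U(σ, J₀)(K)`, `K₀ = U ∩ GL₃(𝒪)` (stabiliser of the self-dual root `L₀ = 𝒪³`), `g₁ = diag(1, 1, ϖ)`,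
`K₁ = U ∩ g₁ GL₃(𝒪) g₁⁻¹` (stabiliser of the type-two vertex `N₁ = g₁·L₀`), `K₀ ⊓ K₁` the Iwahori — the spellings of ★ `UnitaryLatticeTreeFixedCosetFlags` ∕ ★ p852870.  Then for every
`γ ∈ U` with FINITELY many fixed cosets in `U ⧸ K₀` and in `U ⧸ K₁` and a FINITE `⟨γ⟩`-orbit of the root coset,
`#Fix_γ(U ⧸ K₀) + #Fix_γ(U ⧸ K₁) = #Fix_γ(U ⧸ (K₀ ⊓ K₁)) + 1` — the conclusion of the unramified ★ `natCard_fixedBy_add_eq_natCard_fixedBy_inf_add_one_three` TOKEN FOR TOKEN.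
PROOF = that theorem's, re-lettered row by row over the datum-free twins (census «(G2)∕(G1)-RAM» v1 §1, F0P2-p02): tree ★ `isTree_latticeGraph_three_of_neg`, root ★
`isSelfDualLattice_stdLattice_three_of_v`, types ★ `type_of_lt_three` ∕ ★ `not_isSelfDualLattice_of_isVertexLattice_two_of_v`, (A) ★ `exists_unitary_mapGL_stdLattice_eq_of_isSelfDualLattice_of_trace`
at `t = 1∕2`, (B) ★ `forall_isVertexLattice_two_exists_mapGL_N₁_eq_of_neg`, (I) ★ `exists_mem_unitaryInt_eq_mapGL_N₁_of_lt_of_trace` + ★ `isVertexLattice_two_N₁_of_v`, the dictionaries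
(A)(B)(I) of ★ FILE 1 and ★ `RootedTree.ncard_fixedPoints_eq_ncard_fixedEdges_add_one`.  At a tame ramified place both vertex types are special (neither hyperspecial) and the tree is
`(q+1)`-regular — irrelevant to (E).  This is the `hE` binder of ★ `RankOneEulerPoincareGlue` for the quasi-split `U(3)` at a TAME RAMIFIED place: Kottwitz's `Φ(γ, f_EP) = χ(𝒯^γ) = 1`.
[cite: Kottwitz1988, §2] [cite: Serre1980Trees, I.6.1, II.1.1] [cite: BruhatTits1972, §10] [cite: Tits1979, §2.4, §3.5] [cite: Rogawski1990, §12.3 p. 176] -/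
theorem natCard_fixedBy_add_eq_natCard_fixedBy_inf_add_one_three_of_neg (hσ : ∀ x, σ (σ x) = x) (hvσ : ∀ a, Valued.v (σ a) = Valued.v a) (hϖ : Valued.v ϖ = WithZero.exp (-1 : ℤ)) (hσϖ : σ ϖ = -ϖ)
    (hres : ∀ x : K, Valued.v x ≤ 1 → Valued.v (σ x - x) < 1) (h2 : Valued.v (2 : K) = 1)
    (hnorm : ∀ u : K, σ u = u → Valued.v (u - 1) < 1 → ∃ z : K, z * σ z = u ∧ Valued.v (z - 1) ≤ Valued.v (u - 1))
    (g₁ : GL (Fin 3) K) (hg₁ : (g₁ : Matrix (Fin 3) (Fin 3) K) = Matrix.diagonal ![(1 : K), 1, ϖ])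
    (γ : ↥(unitaryGroupOfForm σ ((StdForm.antidiagonal 3).over K)))
    (hK₀fin : (MulAction.fixedBy (↥(unitaryGroupOfForm σ ((StdForm.antidiagonal 3).over K)) ⧸
      (glInt 3 K).subgroupOf (unitaryGroupOfForm σ ((StdForm.antidiagonal 3).over K))) γ).Finite)
    (hK₁fin : (MulAction.fixedBy (↥(unitaryGroupOfForm σ ((StdForm.antidiagonal 3).over K)) ⧸
      ((glInt 3 K).map (MulAut.conj g₁).toMonoidHom).subgroupOf (unitaryGroupOfForm σ ((StdForm.antidiagonal 3).over K))) γ).Finite)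
    (horb : (Set.range fun n : ℕ => ((γ ^ n : ↥(unitaryGroupOfForm σ ((StdForm.antidiagonal 3).over K))) :
      ↥(unitaryGroupOfForm σ ((StdForm.antidiagonal 3).over K)) ⧸ (glInt 3 K).subgroupOf (unitaryGroupOfForm σ ((StdForm.antidiagonal 3).over K)))).Finite) :
    Nat.card (MulAction.fixedBy (↥(unitaryGroupOfForm σ ((StdForm.antidiagonal 3).over K)) ⧸
        (glInt 3 K).subgroupOf (unitaryGroupOfForm σ ((StdForm.antidiagonal 3).over K))) γ) +
      Nat.card (MulAction.fixedBy (↥(unitaryGroupOfForm σ ((StdForm.antidiagonal 3).over K)) ⧸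
        ((glInt 3 K).map (MulAut.conj g₁).toMonoidHom).subgroupOf (unitaryGroupOfForm σ ((StdForm.antidiagonal 3).over K))) γ) =
      Nat.card (MulAction.fixedBy (↥(unitaryGroupOfForm σ ((StdForm.antidiagonal 3).over K)) ⧸
        ((glInt 3 K).subgroupOf (unitaryGroupOfForm σ ((StdForm.antidiagonal 3).over K)) ⊓
          ((glInt 3 K).map (MulAut.conj g₁).toMonoidHom).subgroupOf (unitaryGroupOfForm σ ((StdForm.antidiagonal 3).over K)))) γ) + 1 := by
  classical
  have hϖ0 : ϖ ≠ 0 := uniformizer_ne_zero hϖ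
  have hϖ1 : Valued.v ϖ ≤ 1 := uniformizer_mem_integer hϖ
  have h20 : (2 : K) ≠ 0 := fun h => by rw [h, map_zero] at h2; exact zero_ne_one h2
  have htrace : ∃ t : K, Valued.v t ≤ 1 ∧ t + σ t = 1 :=
    ⟨2⁻¹, by rw [Valuation.map_inv, h2, inv_one], by rw [map_inv₀ σ (2 : K), map_ofNat σ 2, ← two_mul, mul_inv_cancel₀ h20]⟩
  have hT := isTree_latticeGraph_three_of_neg hσ hvσ hϖ hσϖ hres h2 hnorm
  have hroot : IsSelfDualLattice σ ϖ ((StdForm.antidiagonal 3).over K) (stdLattice K 3) := isSelfDualLattice_stdLattice_three_of_v hϖ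
  have hnot : ∀ M : Submodule (Valued.integer K) (Fin 3 → K), IsVertexLattice σ ϖ ((StdForm.antidiagonal 3).over K) 2 M →
      ¬ IsSelfDualLattice σ ϖ ((StdForm.antidiagonal 3).over K) M := fun M hM2 => not_isSelfDualLattice_of_isVertexLattice_two_of_v hvσ hϖ hM2
  -- the base edge `N₁ = g₁·L₀ < L₀`
  have hN₁ : mapGL g₁ (stdLattice K 3) = latt (Matrix.diagonal ![(1 : K), 1, ϖ]) := by rw [← hg₁]; rfl
  have hg₁2 : IsVertexLattice σ ϖ ((StdForm.antidiagonal 3).over K) 2 (mapGL g₁ (stdLattice K 3)) := by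
    rw [hN₁]; exact isVertexLattice_two_N₁_of_v hvσ hϖ1 hϖ0
  have hlt₁ : mapGL g₁ (stdLattice K 3) < stdLattice K 3 := by
    have h := mapGL_N₁_lt_stdLattice_of_v hvσ hϖ (isVertexLattice_two_N₁_of_v hvσ hϖ1 hϖ0) (Subgroup.one_mem (unitaryInt σ ((StdForm.antidiagonal 3).over K)))
    rwa [Subgroup.coe_one, mapGL_one, ← hN₁] at h
  -- the three transitivities, for the unramified datum
  have hA : ∀ M : Submodule (Valued.integer K) (Fin 3 → K), IsSelfDualLattice σ ϖ ((StdForm.antidiagonal 3).over K) M →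
      ∃ u : ↥(unitaryGroupOfForm σ ((StdForm.antidiagonal 3).over K)), mapGL (u : GL (Fin 3) K) (stdLattice K 3) = M := fun M hM =>
    exists_unitary_mapGL_stdLattice_eq_of_isSelfDualLattice_of_trace hσ hvσ hϖ htrace hM
  have hB : ∀ M : Submodule (Valued.integer K) (Fin 3 → K), IsVertexLattice σ ϖ ((StdForm.antidiagonal 3).over K) 2 M →
      ∃ u : ↥(unitaryGroupOfForm σ ((StdForm.antidiagonal 3).over K)), mapGL ((u : GL (Fin 3) K) * g₁) (stdLattice K 3) = M := by
    intro M hM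
    obtain ⟨u, hu⟩ := forall_isVertexLattice_two_exists_mapGL_N₁_eq_of_neg hσ hvσ hϖ hσϖ hres h2 hnorm M hM
    exact ⟨u, by rw [mapGL_mul, hN₁, hu]⟩
  have hI := forall_flag_exists_unitary_of_v_two hσ hvσ hϖ h2 g₁ hg₁
  obtain ⟨eA, -⟩ := exists_fixedBy_equiv_fixed_selfDual_rankN σ ϖ _ hroot hA γ
  obtain ⟨eB, -⟩ := exists_fixedBy_conj_equiv_fixed_type σ ϖ _ hg₁2 hB γ
  obtain ⟨eI, -⟩ := exists_fixedBy_inf_equiv_fixed_flags_rankN σ ϖ _ hroot hg₁2 hlt₁ hI γ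
  obtain ⟨eP⟩ := nonempty_fixed_flags_equiv_fixed_edges_three_of_v hvσ hϖ γ
  haveI : Finite (MulAction.fixedBy (↥(unitaryGroupOfForm σ ((StdForm.antidiagonal 3).over K)) ⧸
      (glInt 3 K).subgroupOf (unitaryGroupOfForm σ ((StdForm.antidiagonal 3).over K))) γ) := hK₀fin.to_subtype
  haveI : Finite (MulAction.fixedBy (↥(unitaryGroupOfForm σ ((StdForm.antidiagonal 3).over K)) ⧸
      ((glInt 3 K).map (MulAut.conj g₁).toMonoidHom).subgroupOf (unitaryGroupOfForm σ ((StdForm.antidiagonal 3).over K))) γ) := hK₁fin.to_subtype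
  have hfinA : {v : {M : Submodule (Valued.integer K) (Fin 3 → K) // IsVertex σ ϖ ((StdForm.antidiagonal 3).over K) M} |
      latticeGraphIso σ ϖ ((StdForm.antidiagonal 3).over K) γ v = v ∧ IsSelfDualLattice σ ϖ ((StdForm.antidiagonal 3).over K) v.1}.Finite :=
    Set.finite_coe_iff.1 (Finite.of_equiv _ eA)
  have hfinB : {v : {M : Submodule (Valued.integer K) (Fin 3 → K) // IsVertex σ ϖ ((StdForm.antidiagonal 3).over K) M} |
      latticeGraphIso σ ϖ ((StdForm.antidiagonal 3).over K) γ v = v ∧ IsVertexLattice σ ϖ ((StdForm.antidiagonal 3).over K) 2 v.1}.Finite :=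
    Set.finite_coe_iff.1 (Finite.of_equiv _ eB)
  have hunion : {v : {M : Submodule (Valued.integer K) (Fin 3 → K) // IsVertex σ ϖ ((StdForm.antidiagonal 3).over K) M} | latticeGraphIso σ ϖ ((StdForm.antidiagonal 3).over K) γ v = v} =
      {v | latticeGraphIso σ ϖ ((StdForm.antidiagonal 3).over K) γ v = v ∧ IsSelfDualLattice σ ϖ ((StdForm.antidiagonal 3).over K) v.1} ∪
        {v | latticeGraphIso σ ϖ ((StdForm.antidiagonal 3).over K) γ v = v ∧ IsVertexLattice σ ϖ ((StdForm.antidiagonal 3).over K) 2 v.1} := by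
    ext v
    simp only [Set.mem_setOf_eq, Set.mem_union]
    constructor
    · intro h
      obtain ⟨d, hvd⟩ := v.2
      rcases type_eq_zero_or_two_of_isVertexLattice_three hvσ hϖ v_det_antidiagonal_three hvd with rfl | rfl
      · exact Or.inl ⟨h, hvd⟩
      · exact Or.inr ⟨h, hvd⟩
    · rintro (⟨h, -⟩ | ⟨h, -⟩) <;> exact h
  have hfin : {v : {M : Submodule (Valued.integer K) (Fin 3 → K) // IsVertex σ ϖ ((StdForm.antidiagonal 3).over K) M} |
      latticeGraphIso σ ϖ ((StdForm.antidiagonal 3).over K) γ v = v}.Finite := by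
    rw [hunion]
    exact hfinA.union hfinB
  obtain ⟨v₀, hv₀⟩ := exists_latticeGraphIso_apply_eq_self_three_of_neg hσ hvσ hϖ hσϖ hres h2 hnorm γ horb
  have hE := RootedTree.ncard_fixedPoints_eq_ncard_fixedEdges_add_one hT (latticeGraphIso σ ϖ ((StdForm.antidiagonal 3).over K) γ) hfin hv₀
  rw [hunion, Set.ncard_union_eq (Set.disjoint_left.2 fun v hv hv' => hnot _ hv'.2 hv.2) hfinA hfinB] at hE
  rw [Nat.card_congr eA, Nat.card_congr eB, Nat.card_congr (eI.trans eP), Nat.card_coe_set_eq, Nat.card_coe_set_eq, hE, Nat.card_coe_set_eq]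

end ThreeRamified

end Literature.NumberTheory.Automorphic.UnitaryLatticeTree

end
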